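import Mathlib
import Literature.Probability.LatticeModels.GriffithsMonotonicity
import Literature.Probability.LatticeModels.GKSInequalities
import Literature.Probability.LatticeModels.ThermodynamicLimit
import HarnessLib

/-!
# Walsh (Fourier–Walsh) inversion on the spin hypercube of a finite volume

Finite harmonic analysis on the hypercube `{±1}^Λ` of Ising configurations `τ : Λ → ℤˣ` of a
finite volume `Λ : Finset V`, phrased with the tree's `spinProduct` and `glue` (plus boundary
condition outside `Λ`, invisible to `σ_A` for `A ⊆ Λ`). The characters of the group `(ℤ/2)^Λ` are
the spin products `τ ↦ σ_A(τ)`, `A ⊆ Λ`, and we prove the textbook package [folklore]: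
flipping one spin negates `σ_A` exactly when the site lies in `A`
(`spinProduct_glue_update_neg` / `…_of_notMem`); `∑_τ σ_A(τ) = 0` for `∅ ≠ A ⊆ Λ`
(`sum_cfg_spinProduct_eq_zero`, the `±1` symmetry trick); orthogonality
`∑_τ σ_A σ_B = 2^{|Λ|} δ_{A,B}` (`sum_cfg_spinProduct_mul_spinProduct`); and Walsh inversion: the
signed density `ρ_E(τ) = 2^{-|Λ|} ∑_{A ⊆ Λ} σ_A(τ) E(A)` has moments `∑_τ ρ_E σ_B = E(B)` for
`B ⊆ Λ` and total mass `E(∅)` (`walsh_inversion`, `walsh_total_mass`), and is pointwise `≥ 0` as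
soon as `∑_{A ⊆ Λ} σ_A E(A) ≥ 0` for every configuration (`walsh_density_nonneg`). This is the
tool that realises a prescribed moment functional `E` on `Λ` as an honest (signed) measure on
configurations. Deliberately not here: Gibbs weights, boundary effects, infinite volume.
-/

noncomputable section

namespace Summit.CriticalPhenomena.Ising3DConformalLimit.Theorems

open Literature.Probability.LatticeModels Finset
open scoped symmDiff

variable {V : Type*} [DecidableEq V]


/-- **Flipping a spin inside `A` negates `σ_A`.** For `A ⊆ Λ`, a configuration `τ` of `Λ` and a
site `i ∈ A`, replacing `τ_i` by `-τ_i` changes `σ_A` (evaluated on the configuration glued with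
the `+` boundary condition) into `-σ_A`. [folklore] -/
theorem spinProduct_glue_update_neg {Λ : Finset V} {A : Finset V} (hA : A ⊆ Λ) (τ : ↥Λ → ℤˣ)
    (i : ↥Λ) (hi : (i : V) ∈ A) :
    spinProduct A (glue Λ (Function.update τ i (-τ i)) .plus) =
      - spinProduct A (glue Λ τ .plus) := by
  rw [spinProduct, spinProduct, ← mul_prod_erase A _ hi, ← mul_prod_erase A _ hi, ← neg_mul]
  congr 1
  · simp [spinAt]
  · refine prod_congr rfl fun v hv => ?_
    have hvi : v ≠ (i : V) := ne_of_mem_erase hv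
    have hvΛ : v ∈ Λ := hA (mem_of_mem_erase hv)
    have hne : (⟨v, hvΛ⟩ : ↥Λ) ≠ i := fun h => hvi (congrArg Subtype.val h)
    simp [spinAt, glue_apply_of_mem _ _ _ hvΛ, Function.update_of_ne hne]

/-- **Flipping a spin outside `A` does not change `σ_A`.** For a configuration `τ` of `Λ` and a
site `i ∉ A` of `Λ`, replacing `τ_i` by `-τ_i` leaves `σ_A` unchanged. [folklore] -/
theorem spinProduct_glue_update_of_notMem {Λ : Finset V} {A : Finset V} (τ : ↥Λ → ℤˣ)
    (i : ↥Λ) (hi : (i : V) ∉ A) :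
    spinProduct A (glue Λ (Function.update τ i (-τ i)) .plus) =
      spinProduct A (glue Λ τ .plus) := by
  unfold spinProduct
  refine prod_congr rfl fun v hv => ?_
  by_cases hvΛ : v ∈ Λ
  · have hne : (⟨v, hvΛ⟩ : ↥Λ) ≠ i := by
      rintro rfl
      exact hi hv
    simp [spinAt, glue_apply_of_mem _ _ _ hvΛ, Function.update_of_ne hne]
  · simp [spinAt, glue_apply_of_notMem _ _ _ hvΛ]

/-- **Orthogonality to constants (the `±1` symmetry trick).** For a nonempty `A ⊆ Λ`,
`∑_τ σ_A(τ) = 0`, the sum running over all `2^{|Λ|}` configurations of `Λ`: the involution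
flipping the spin at a point of `A` negates the summand. [folklore] -/
theorem sum_cfg_spinProduct_eq_zero {Λ : Finset V} {A : Finset V} (hA : A ⊆ Λ)
    (hne : A.Nonempty) :
    ∑ τ : ↥Λ → ℤˣ, spinProduct A (glue Λ τ .plus) = 0 := by
  obtain ⟨a, ha⟩ := hne
  have hinv : Function.Involutive
      (fun τ : ↥Λ → ℤˣ => Function.update τ ⟨a, hA ha⟩ (-τ ⟨a, hA ha⟩)) := by
    intro τ
    funext v
    rcases eq_or_ne v ⟨a, hA ha⟩ with rfl | hv
    · simp
    · simp [Function.update_of_ne hv]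
  have h := Fintype.sum_bijective _ hinv.bijective
    (fun τ => spinProduct A (glue Λ (Function.update τ ⟨a, hA ha⟩ (-τ ⟨a, hA ha⟩)) .plus))
    (fun τ => spinProduct A (glue Λ τ .plus)) (fun _ => rfl)
  simp only [spinProduct_glue_update_neg hA _ ⟨a, hA ha⟩ ha, sum_neg_distrib] at h
  linarith

/-- **Orthogonality relations of the Walsh characters.** For `A, B ⊆ Λ`,
`∑_τ σ_A(τ) σ_B(τ) = 2^{|Λ|}` if `A = B` and `= 0` otherwise (since `σ_A σ_B = σ_{A ∆ B}`).
[folklore] -/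
theorem sum_cfg_spinProduct_mul_spinProduct {Λ : Finset V} {A B : Finset V} (hA : A ⊆ Λ)
    (hB : B ⊆ Λ) :
    ∑ τ : ↥Λ → ℤˣ, spinProduct A (glue Λ τ .plus) * spinProduct B (glue Λ τ .plus) =
      if A = B then (2 : ℝ) ^ Λ.card else 0 := by
  simp_rw [spinProduct_mul_spinProduct]
  split_ifs with h
  · subst h
    simp [spinProduct_empty]
  · exact sum_cfg_spinProduct_eq_zero ((symmDiff_subset_union).trans (union_subset hA hB))
      (symmDiff_nonempty.2 h)

/-- **Walsh inversion.** For any set function `E` and `B ⊆ Λ`, the signed density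
`ρ_E(τ) = 2^{-|Λ|} ∑_{A ⊆ Λ} σ_A(τ) E(A)` on configurations of `Λ` reproduces the moment
`∑_τ ρ_E(τ) σ_B(τ) = E(B)` (finite Fourier inversion on `(ℤ/2)^Λ`). [folklore] -/
theorem walsh_inversion {Λ : Finset V} (E : Finset V → ℝ) {B : Finset V} (hB : B ⊆ Λ) :
    ∑ τ : ↥Λ → ℤˣ, (((2 : ℝ) ^ Λ.card)⁻¹ *
        ∑ A ∈ Λ.powerset, spinProduct A (glue Λ τ .plus) * E A) *
        spinProduct B (glue Λ τ .plus) = E B := by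
  have h2 : (2 : ℝ) ^ Λ.card ≠ 0 := pow_ne_zero _ two_ne_zero
  have key : ∀ A ∈ Λ.powerset,
      ∑ τ : ↥Λ → ℤˣ, spinProduct A (glue Λ τ .plus) * E A * spinProduct B (glue Λ τ .plus) =
        if A = B then (2 : ℝ) ^ Λ.card * E A else 0 := by
    intro A hA
    calc ∑ τ : ↥Λ → ℤˣ, spinProduct A (glue Λ τ .plus) * E A * spinProduct B (glue Λ τ .plus)
        = E A * ∑ τ : ↥Λ → ℤˣ,
            spinProduct A (glue Λ τ .plus) * spinProduct B (glue Λ τ .plus) := by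
          rw [mul_sum]
          exact sum_congr rfl fun τ _ => by ring
      _ = if A = B then (2 : ℝ) ^ Λ.card * E A else 0 := by
          rw [sum_cfg_spinProduct_mul_spinProduct (mem_powerset.1 hA) hB]
          split_ifs <;> ring
  calc ∑ τ : ↥Λ → ℤˣ, (((2 : ℝ) ^ Λ.card)⁻¹ *
        ∑ A ∈ Λ.powerset, spinProduct A (glue Λ τ .plus) * E A) * spinProduct B (glue Λ τ .plus)
      = ((2 : ℝ) ^ Λ.card)⁻¹ * ∑ A ∈ Λ.powerset, ∑ τ : ↥Λ → ℤˣ,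
          spinProduct A (glue Λ τ .plus) * E A * spinProduct B (glue Λ τ .plus) := by
        rw [sum_comm, mul_sum]
        exact sum_congr rfl fun τ _ => by rw [mul_assoc, sum_mul]
    _ = ((2 : ℝ) ^ Λ.card)⁻¹ * ∑ A ∈ Λ.powerset,
          if A = B then (2 : ℝ) ^ Λ.card * E A else 0 := by rw [sum_congr rfl key]
    _ = E B := by rw [sum_ite_eq', if_pos (mem_powerset.2 hB), inv_mul_cancel_left₀ h2]

/-- **Total mass of the Walsh density.** For any set function `E`,
`∑_τ 2^{-|Λ|} ∑_{A ⊆ Λ} σ_A(τ) E(A) = E(∅)` (Walsh inversion at `B = ∅`, `σ_∅ = 1`).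
[folklore] -/
theorem walsh_total_mass {Λ : Finset V} (E : Finset V → ℝ) :
    ∑ τ : ↥Λ → ℤˣ, ((2 : ℝ) ^ Λ.card)⁻¹ *
        ∑ A ∈ Λ.powerset, spinProduct A (glue Λ τ .plus) * E A = E ∅ := by
  simpa only [spinProduct_empty, mul_one] using walsh_inversion E (empty_subset Λ)

omit [DecidableEq V] in
/-- **Nonnegativity transfer.** If `∑_{A ⊆ Λ} σ_A E(A) ≥ 0` at every spin configuration `σ`,
then the Walsh density `2^{-|Λ|} ∑_{A ⊆ Λ} σ_A(τ) E(A)` is nonnegative at every configuration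
`τ` of `Λ` (so, with `walsh_total_mass`/`walsh_inversion`, it is a probability with moments `E`
when `E(∅) = 1`). [folklore] -/
theorem walsh_density_nonneg {Λ : Finset V} (E : Finset V → ℝ)
    (hpos : ∀ σ : SpinConfig V, 0 ≤ ∑ A ∈ Λ.powerset, spinProduct A σ * E A) (τ : ↥Λ → ℤˣ) :
    0 ≤ ((2 : ℝ) ^ Λ.card)⁻¹ * ∑ A ∈ Λ.powerset, spinProduct A (glue Λ τ .plus) * E A :=
  mul_nonneg (inv_nonneg.2 (pow_nonneg zero_le_two _)) (hpos _)

/-- **Registered sub-goal `walsh_inversion_site3` of item stmt-CriticalPhenomena-5504** (Walsh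
inversion on boxes of `ℤ³`, one line, fully qualified): proof = `walsh_inversion`. [folklore] -/
theorem walsh_inversion_site3 : ∀ (Λ : Finset (Literature.Probability.LatticeModels.Site 3)) (E : Finset (Literature.Probability.LatticeModels.Site 3) → ℝ) (B : Finset (Literature.Probability.LatticeModels.Site 3)), B ⊆ Λ → ∑ τ : ↥Λ → ℤˣ, (((2 : ℝ) ^ Λ.card)⁻¹ * ∑ A ∈ Λ.powerset, Literature.Probability.LatticeModels.spinProduct A (Literature.Probability.LatticeModels.glue Λ τ Literature.Probability.LatticeModels.BoundaryCondition.plus) * E A) * Literature.Probability.LatticeModels.spinProduct B (Literature.Probability.LatticeModels.glue Λ τ Literature.Probability.LatticeModels.BoundaryCondition.plus) = E B :=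
  fun _ E _ hB => walsh_inversion E hB

end Summit.CriticalPhenomena.Ising3DConformalLimit.Theorems

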